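import Literature.Analysis.Matrix.CGErrorEstimate
import HarnessLib

/-!
# Meurant–Tichý's upper bound for the `A`-norm of the CG error:
# `‖x − x_k‖_A² ≤ ‖r_k‖⁴ / (μ ‖p_k‖²)` for `0 < μ ≤ λ_min(A)`, and the minimal-residual identity
# `‖r_k‖⁴/‖p_k‖² = (Σ_{j≤k} ‖r_j‖⁻²)⁻¹`

Topic `Analysis/Matrix`; companion of `CGErrorEstimate.lean` (the Hestenes–Stiefel recursion
`cgState`, the Gauss LOWER bound `Σ γ_j‖r_j‖² ≤ ‖x − x_k‖_A²` and the `κ(A)` sandwich).  That file's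
upper estimate needs BOTH spectral ends (`Δ_k ≤ ε_k ≤ κ Δ_k`); the bound of this file needs only an
underestimate `μ` of the smallest eigenvalue and two scalars the recursion already holds, and is
sharper than the textbook residual bound `‖r_k‖²/μ` by the factor `‖r_k‖²/‖p_k‖² ≤ 1`.  PUBLISHED
RESULT with our proof (a direct one — see below); no definition and no named fact (`def … : Prop`)
is introduced (D-0026).

HONEST FRAMING: exact (Metropolis-corrected) sampling algorithms for lattice gauge theory; figures
of merit are autocorrelation/cost numbers at stated couplings and volumes; no continuum-physics claim.

## Source (read on the materialised text) and what is taken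

G. Meurant, P. Tichý, *Approximating the extreme Ritz values and upper bounds for the `A`-norm of the
error in CG*, Numer. Algorithms 82 (2019) 937–968 = arXiv:1810.02127 [MeurantTichy2018] (held text
`paper:arxiv-1810.02127`, chunk p0006 = §3 "Quadrature-based bounds and a new upper bound"):
"(eq:basic) `γ_k‖r_k‖² < ‖x − x_k‖_A² < γ_k^{(μ)}‖r_k‖²` … `μ` such that `0 < μ ≤ λ_min`";
"This bound depends on the ratio `φ_k ≡ ‖r_k‖²/‖p_k‖²` … using `p_k = r_k + δ_k p_{k−1}` and the
orthogonality between `r_k` and `p_{k−1}` (local orthogonality), we obtain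
`‖p_k‖² = ‖r_k‖²(1 + δ_k ‖p_{k−1}‖²/‖r_{k−1}‖²)`, and, therefore, (eq:phi)
`φ_k = φ_{k−1}/(φ_{k−1} + δ_k)`, `φ_0 = 1` … by induction … (eq:minres)
`‖r_k‖² φ_k = (Σ_{j=0}^{k} ‖r_j‖⁻²)⁻¹`; see also [HeSt1952]. Note that mathematically, the quantity
(eq:minres) can be interpreted as the norm of the residual vector determined by the minimal residual
method"; **Theorem 1.** "Let `0 < μ ≤ λ_min` be given. The approximations `x_k`, `k < n`, generated
by the CG method satisfy (eq:newbound) `‖x − x_k‖_A² < (‖r_k‖²/μ)(‖r_k‖²/‖p_k‖²)`, and the bound is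
decreasing with increasing `k`."  The printed proof goes through the Gauss–Radau coefficient
`γ_k^{(μ)}` ("it is sufficient to show that `μγ_k^{(μ)} ≤ φ_k`"); the proof here is DIRECT and uses
only what the tree has: by (eq:minres) the right-hand side is `‖r^{MR}_k‖²/μ` where `r^{MR}_k` is the
minimal residual over the affine combinations `y = Σ_{j≤k} c_j x_j` (`Σ c_j = 1`) of the CG iterates
— all of which lie in `x₀ + 𝒦_k(A, r₀)` and have residual `Σ c_j r_j` —, and `‖x − x_k‖_A² ≤
‖x − y‖_A² = (b − Ay)ᵀA⁻¹(b − Ay) ≤ ‖b − Ay‖²/μ` by the `A`-norm optimality of the CG iterate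
(`CGErrorEstimate.aNormSq_error_cgState_le`, Saad Prop. 5.2) and `λ_min(A) ≥ μ`.  We obtain the
non-strict inequality `≤` for every `k` (the printed `<` for `k < n` is not asserted).

## What is formalised (`A : Matrix ι ι ℝ` positive definite, `cgState A b x₀ k = (x_k, r_k, p_k)`)

* `cgState_normSq_p_succ` — MT's local identity `‖p_{k+1}‖² = ‖r_{k+1}‖² + δ_{k+1}²‖p_k‖²`;
* **`cgState_normSq_p_eq`** — (eq:minres) in the form `‖p_k‖² = ‖r_k‖⁴ · Σ_{j≤k} ‖r_j‖⁻²` (while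
  `r_k ≠ 0`), i.e. `‖r_k‖²φ_k = (Σ_{j≤k}‖r_j‖⁻²)⁻¹`;
* `affineComb_sub_mem_krylov`, `residual_affineComb` — for `Σ_{j≤k} c_j = 1`, the point
  `y = Σ c_j x_j` lies in `x₀ + 𝒦_k(A, r₀)` and `b − Ay = Σ c_j r_j`;
  `normSq_sum_smul_r` — `‖Σ c_j r_j‖² = Σ c_j²‖r_j‖²` (orthogonal residuals);
  **`normSq_residual_affineComb_ge`** — every such residual has `‖b − Ay‖² ≥ (Σ_{j≤k}‖r_j‖⁻²)⁻¹`
  (Cauchy–Schwarz) and `normSq_residual_minRes` — the weights `c_j ∝ ‖r_j‖⁻²` attain it: the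
  "minimal residual" value of (eq:minres);
* `aNormSq_le_normSq_residual_div` — `(x − y)ᵀA(x − y) ≤ ‖b − Ay‖²/μ` for `λ(A) ≥ μ > 0`;
* **`aNormSq_error_cgState_le_minRes`** — `‖x − x_k‖_A² ≤ (Σ_{j≤k}‖r_j‖⁻²)⁻¹/μ`;
  **`aNormSq_error_cgState_le_meurantTichy`** — THEOREM 1: `‖x − x_k‖_A² ≤ ‖r_k‖⁴/(μ‖p_k‖²)`;
  `meurantTichy_le_residual_bound` — it improves the residual bound: `‖r_k‖⁴/(μ‖p_k‖²) ≤ ‖r_k‖²/μ`;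
  `aNormSq_error_cgState_le_meurantTichy_delay` — the delayed form
  `‖x − x_k‖_A² ≤ Σ_{j=k}^{k+d−1} γ_j‖r_j‖² + ‖r_{k+d}‖⁴/(μ‖p_{k+d}‖²)`;
  `minRes_bound_antitone` — "the bound is decreasing with increasing `k`".

NOT formalised: the Gauss–Radau coefficient `γ_k^{(μ)}`, its update (eq:gamma) and the chain
`‖x − x_k‖_A² < γ_k^{(μ)}‖r_k‖² < ‖r_k‖⁴/(μ‖p_k‖²)` of the printed proof; the Gauss–Radau delayed
version (eq:delayupper); the Ritz-value estimates of §4; finite precision.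

Context (cell pub-lqcd, HOME/R2-SCOPE.md §3 E5 "accept-step solver residual": a GUARANTEED upper
bound for the `A`-norm error of the pseudofermion solve — hence, with `CGErrorEstimate`'s lower bound,
a certified two-sided bracket for `φᵀ(D†D)⁻¹φ − φᵀx_k`-type accept-step quantities — from the two
scalars `‖r_k‖²`, `‖p_k‖²` the solver already has and one spectral underestimate `μ` (for
`D†D + m²`-type kernels `μ = m²` is available a priori)).  No continuum-physics claim.
-/

noncomputable section

open scoped Matrix
open Finset

namespace Literature.Analysis.Matrix

namespace ConjugateGradient

open _root_.Matrix

variable {ι : Type*} [Fintype ι]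

/-- `0 ≤ vᵀv`. [folklore] -/
private theorem dotProduct_self_nonneg₄ (v : ι → ℝ) : 0 ≤ v ⬝ᵥ v :=
  Fintype.sum_nonneg fun i => mul_self_nonneg (v i)

/-- `v ≠ 0 ⇒ 0 < vᵀv`. [folklore] -/
private theorem dotProduct_self_pos₄ {v : ι → ℝ} (hv : v ≠ 0) : 0 < v ⬝ᵥ v :=
  lt_of_le_of_ne (dotProduct_self_nonneg₄ v) fun h => hv (dotProduct_self_eq_zero.mp h.symm)

/-! ### The ratio `φ_k = ‖r_k‖²/‖p_k‖²` and the minimal-residual identity (eq:minres) -/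

/-- `r_{k+1} ⊥ p_k`, hence **`‖p_{k+1}‖² = ‖r_{k+1}‖² + δ_{k+1}² ‖p_k‖²`** ("using `p_k = r_k +
δ_k p_{k−1}` and the orthogonality between `r_k` and `p_{k−1}` (local orthogonality)").
[cite: MeurantTichy2018, §3 (display before (eq:phi))] -/
theorem cgState_normSq_p_succ {A : Matrix ι ι ℝ} (hA : A.PosDef) (b x₀ : ι → ℝ) (k : ℕ) :
    (cgState A b x₀ (k + 1)).p ⬝ᵥ (cgState A b x₀ (k + 1)).p =
      (cgState A b x₀ (k + 1)).r ⬝ᵥ (cgState A b x₀ (k + 1)).r +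
        (((cgState A b x₀ (k + 1)).r ⬝ᵥ (cgState A b x₀ (k + 1)).r) /
            ((cgState A b x₀ k).r ⬝ᵥ (cgState A b x₀ k).r)) ^ 2 *
          ((cgState A b x₀ k).p ⬝ᵥ (cgState A b x₀ k).p) := by
  set δ := ((cgState A b x₀ (k + 1)).r ⬝ᵥ (cgState A b x₀ (k + 1)).r) /
      ((cgState A b x₀ k).r ⬝ᵥ (cgState A b x₀ k).r)
  have hp : (cgState A b x₀ (k + 1)).p = (cgState A b x₀ (k + 1)).r + δ • (cgState A b x₀ k).p :=
    cgState_succ_p A b x₀ k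
  have horth : (cgState A b x₀ k).p ⬝ᵥ (cgState A b x₀ (k + 1)).r = 0 :=
    cgState_p_dotProduct_r_succ hA b x₀ k
  rw [hp]
  simp only [add_dotProduct, dotProduct_add, smul_dotProduct, dotProduct_smul, smul_eq_mul, horth,
    dotProduct_comm ((cgState A b x₀ (k + 1)).r) ((cgState A b x₀ k).p)]
  ring

/-- **(eq:minres): `‖p_k‖² = ‖r_k‖⁴ · Σ_{j≤k} ‖r_j‖⁻²`** while `r_k ≠ 0` — equivalently
`‖r_k‖² φ_k = (Σ_{j=0}^{k} ‖r_j‖⁻²)⁻¹` with `φ_k = ‖r_k‖²/‖p_k‖²`.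
[cite: MeurantTichy2018, §3 eqs. (eq:phi)–(eq:minres) (`φ_k⁻¹ = ‖r_k‖² Σ_{j=0}^{k} ‖r_j‖⁻²`)]
[cite: HestenesStiefel1952, §5 Theorem 5:3 ("see also [HeSt1952]" in the source)] -/
theorem cgState_normSq_p_eq {A : Matrix ι ι ℝ} (hA : A.PosDef) (b x₀ : ι → ℝ) {k : ℕ}
    (hr : (cgState A b x₀ k).r ≠ 0) :
    (cgState A b x₀ k).p ⬝ᵥ (cgState A b x₀ k).p =
      ((cgState A b x₀ k).r ⬝ᵥ (cgState A b x₀ k).r) ^ 2 *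
        ∑ j ∈ range (k + 1), ((cgState A b x₀ j).r ⬝ᵥ (cgState A b x₀ j).r)⁻¹ := by
  induction k with
  | zero =>
    have h0 : (cgState A b x₀ 0).r ⬝ᵥ (cgState A b x₀ 0).r ≠ 0 := (dotProduct_self_pos₄ hr).ne'
    rw [sum_range_one, cgState_zero_p, ← cgState_zero_r A b x₀]
    field_simp
  | succ k ih =>
    have hrk : (cgState A b x₀ k).r ≠ 0 := fun h => hr (cgState_succ_of_r_eq_zero A b x₀ k h).2
    have h0 : (cgState A b x₀ k).r ⬝ᵥ (cgState A b x₀ k).r ≠ 0 := (dotProduct_self_pos₄ hrk).ne'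
    have h1 : (cgState A b x₀ (k + 1)).r ⬝ᵥ (cgState A b x₀ (k + 1)).r ≠ 0 :=
      (dotProduct_self_pos₄ hr).ne'
    rw [cgState_normSq_p_succ hA b x₀ k, ih hrk, sum_range_succ _ (k + 1)]
    field_simp
    ring

/-! ### Affine combinations of the iterates and the minimal residual -/

/-- **Affine combinations of CG iterates stay in the search space**: if `Σ_{j≤k} c_j = 1` then
`Σ_{j≤k} c_j x_j − x₀ ∈ 𝒦_k(A, r₀)` (each `x_j − x₀ ∈ 𝒦_j ⊆ 𝒦_k`). [cite: MeurantTichy2018, §3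
(the minimal residual method on the CG Krylov spaces, (eq:minres))] [cite: Saad2003, §6.7.1
("`x_m = x₀ + q_{m−1}(A) r₀`")] -/
theorem affineComb_sub_mem_krylov [DecidableEq ι] (A : Matrix ι ι ℝ) (b x₀ : ι → ℝ) (k : ℕ)
    {c : ℕ → ℝ} (hc : ∑ j ∈ range (k + 1), c j = 1) :
    (∑ j ∈ range (k + 1), c j • (cgState A b x₀ j).x) - x₀ ∈ krylov A (b - A *ᵥ x₀) k := by
  have h : (∑ j ∈ range (k + 1), c j • (cgState A b x₀ j).x) - x₀ =
      ∑ j ∈ range (k + 1), c j • ((cgState A b x₀ j).x - x₀) := by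
    simp only [smul_sub, sum_sub_distrib, ← sum_smul, hc, one_smul]
  rw [h]
  refine Submodule.sum_mem _ fun j hj => Submodule.smul_mem _ _ ?_
  exact krylov_mono A _ (Nat.lt_succ_iff.mp (mem_range.mp hj)) (cgState_mem_krylov A b x₀ j).1

/-- **The residual of an affine combination is the same combination of the residuals**:
`b − A(Σ c_j x_j) = Σ c_j r_j` when `Σ c_j = 1`. [cite: MeurantTichy2018, §3 (residual
combinations / residual smoothing: `r_k^S = (1 − φ_k) r_{k−1}^S + φ_k r_k`,
`x_k^S = (1 − φ_k) x_{k−1}^S + φ_k x_k`)] -/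
theorem residual_affineComb (A : Matrix ι ι ℝ) (b x₀ : ι → ℝ) (k : ℕ) {c : ℕ → ℝ}
    (hc : ∑ j ∈ range (k + 1), c j = 1) :
    b - A *ᵥ (∑ j ∈ range (k + 1), c j • (cgState A b x₀ j).x) =
      ∑ j ∈ range (k + 1), c j • (cgState A b x₀ j).r := by
  have h1 : A *ᵥ (∑ j ∈ range (k + 1), c j • (cgState A b x₀ j).x) =
      ∑ j ∈ range (k + 1), c j • (A *ᵥ (cgState A b x₀ j).x) := by
    rw [mulVec_sum]
    exact sum_congr rfl fun j _ => mulVec_smul _ _ _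
  calc b - A *ᵥ (∑ j ∈ range (k + 1), c j • (cgState A b x₀ j).x)
      = (∑ j ∈ range (k + 1), c j • b) - ∑ j ∈ range (k + 1), c j • (A *ᵥ (cgState A b x₀ j).x) := by
        rw [← sum_smul, hc, one_smul, h1]
    _ = ∑ j ∈ range (k + 1), c j • (cgState A b x₀ j).r := by
        rw [← sum_sub_distrib]
        exact sum_congr rfl fun j _ => by rw [← smul_sub, cgState_r]

/-- **Pythagoras for the orthogonal residuals**: `‖Σ_{j≤k} c_j r_j‖² = Σ_{j≤k} c_j² ‖r_j‖²`.
[cite: Saad2003, §6.7.1 ("the residual vectors … are orthogonal to each other")] -/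
theorem normSq_sum_smul_r {A : Matrix ι ι ℝ} (hA : A.PosDef) (b x₀ : ι → ℝ) (k : ℕ) (c : ℕ → ℝ) :
    (∑ j ∈ range (k + 1), c j • (cgState A b x₀ j).r) ⬝ᵥ
        (∑ j ∈ range (k + 1), c j • (cgState A b x₀ j).r) =
      ∑ j ∈ range (k + 1), c j ^ 2 * ((cgState A b x₀ j).r ⬝ᵥ (cgState A b x₀ j).r) := by
  rw [sum_dotProduct]
  refine sum_congr rfl fun j hj => ?_
  rw [dotProduct_sum]
  rw [Finset.sum_eq_single j (fun i _ hij => by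
      rw [smul_dotProduct, dotProduct_smul, smul_eq_mul, smul_eq_mul,
        cgState_r_dotProduct_r_eq_zero hA b x₀ (Ne.symm hij), mul_zero, mul_zero])
      (fun h => absurd hj h)]
  rw [smul_dotProduct, dotProduct_smul, smul_eq_mul, smul_eq_mul]
  ring

/-- **Every affine combination of the residuals is at least the minimal residual**: for
`Σ_{j≤k} c_j = 1` and `r_0, …, r_k ≠ 0`, `Σ c_j²‖r_j‖² ≥ (Σ_{j≤k} ‖r_j‖⁻²)⁻¹` (Cauchy–Schwarz:
`1 = (Σ c_j)² ≤ (Σ c_j²‖r_j‖²)(Σ ‖r_j‖⁻²)`). [cite: MeurantTichy2018, §3 eq. (eq:minres) ("the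
norm of the residual vector determined by the minimal residual method")] -/
theorem normSq_residual_affineComb_ge {A : Matrix ι ι ℝ} (hA : A.PosDef) (b x₀ : ι → ℝ) {k : ℕ}
    (hr : (cgState A b x₀ k).r ≠ 0) {c : ℕ → ℝ} (hc : ∑ j ∈ range (k + 1), c j = 1) :
    (∑ j ∈ range (k + 1), ((cgState A b x₀ j).r ⬝ᵥ (cgState A b x₀ j).r)⁻¹)⁻¹ ≤
      (∑ j ∈ range (k + 1), c j • (cgState A b x₀ j).r) ⬝ᵥ
        (∑ j ∈ range (k + 1), c j • (cgState A b x₀ j).r) := by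
  rw [normSq_sum_smul_r hA b x₀ k c]
  -- abbreviations `n_j = ‖r_j‖²`, all positive
  have hpos : ∀ j ∈ range (k + 1), 0 < (cgState A b x₀ j).r ⬝ᵥ (cgState A b x₀ j).r := by
    intro j hj
    exact dotProduct_self_pos₄ fun h =>
      hr (cgState_r_eq_zero_of_le A b x₀ (Nat.lt_succ_iff.mp (mem_range.mp hj)) h)
  have hS : 0 < ∑ j ∈ range (k + 1), ((cgState A b x₀ j).r ⬝ᵥ (cgState A b x₀ j).r)⁻¹ :=
    sum_pos (fun j hj => inv_pos.mpr (hpos j hj)) ⟨0, by simp⟩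
  -- Cauchy–Schwarz with `f_j = c_j √n_j`, `g_j = 1/√n_j`
  have hcs := sum_mul_sq_le_sq_mul_sq (range (k + 1))
    (fun j => c j * Real.sqrt ((cgState A b x₀ j).r ⬝ᵥ (cgState A b x₀ j).r))
    (fun j => (Real.sqrt ((cgState A b x₀ j).r ⬝ᵥ (cgState A b x₀ j).r))⁻¹)
  have hfg : ∑ j ∈ range (k + 1), c j * Real.sqrt ((cgState A b x₀ j).r ⬝ᵥ (cgState A b x₀ j).r) *
      (Real.sqrt ((cgState A b x₀ j).r ⬝ᵥ (cgState A b x₀ j).r))⁻¹ = 1 := by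
    rw [← hc]
    refine sum_congr rfl fun j hj => ?_
    rw [mul_assoc, mul_inv_cancel₀ (Real.sqrt_pos.mpr (hpos j hj)).ne', mul_one]
  have hf : ∑ j ∈ range (k + 1), (c j * Real.sqrt ((cgState A b x₀ j).r ⬝ᵥ (cgState A b x₀ j).r)) ^ 2
      = ∑ j ∈ range (k + 1), c j ^ 2 * ((cgState A b x₀ j).r ⬝ᵥ (cgState A b x₀ j).r) :=
    sum_congr rfl fun j hj => by rw [mul_pow, Real.sq_sqrt (hpos j hj).le]
  have hg : ∑ j ∈ range (k + 1), ((Real.sqrt ((cgState A b x₀ j).r ⬝ᵥ (cgState A b x₀ j).r))⁻¹) ^ 2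
      = ∑ j ∈ range (k + 1), ((cgState A b x₀ j).r ⬝ᵥ (cgState A b x₀ j).r)⁻¹ :=
    sum_congr rfl fun j hj => by rw [inv_pow, Real.sq_sqrt (hpos j hj).le]
  rw [hfg, hf, hg, one_pow] at hcs
  rw [inv_le_iff_one_le_mul₀ hS]
  exact hcs

/-- **The minimal residual is attained** by the weights `c_j = ‖r_j‖⁻²/Σ_l ‖r_l‖⁻²`:
`‖Σ c_j r_j‖² = (Σ_{j≤k} ‖r_j‖⁻²)⁻¹`. [cite: MeurantTichy2018, §3 eq. (eq:minres)] -/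
theorem normSq_residual_minRes {A : Matrix ι ι ℝ} (hA : A.PosDef) (b x₀ : ι → ℝ) {k : ℕ}
    (hr : (cgState A b x₀ k).r ≠ 0) :
    (∑ j ∈ range (k + 1),
        (((cgState A b x₀ j).r ⬝ᵥ (cgState A b x₀ j).r)⁻¹ /
          ∑ l ∈ range (k + 1), ((cgState A b x₀ l).r ⬝ᵥ (cgState A b x₀ l).r)⁻¹) •
          (cgState A b x₀ j).r) ⬝ᵥ
      (∑ j ∈ range (k + 1),
        (((cgState A b x₀ j).r ⬝ᵥ (cgState A b x₀ j).r)⁻¹ /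
          ∑ l ∈ range (k + 1), ((cgState A b x₀ l).r ⬝ᵥ (cgState A b x₀ l).r)⁻¹) •
          (cgState A b x₀ j).r) =
      (∑ j ∈ range (k + 1), ((cgState A b x₀ j).r ⬝ᵥ (cgState A b x₀ j).r)⁻¹)⁻¹ := by
  rw [normSq_sum_smul_r hA b x₀ k]
  have hpos : ∀ j ∈ range (k + 1), 0 < (cgState A b x₀ j).r ⬝ᵥ (cgState A b x₀ j).r := by
    intro j hj
    exact dotProduct_self_pos₄ fun h =>
      hr (cgState_r_eq_zero_of_le A b x₀ (Nat.lt_succ_iff.mp (mem_range.mp hj)) h)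
  set S := ∑ l ∈ range (k + 1), ((cgState A b x₀ l).r ⬝ᵥ (cgState A b x₀ l).r)⁻¹ with hS_def
  have hS : 0 < S := sum_pos (fun j hj => inv_pos.mpr (hpos j hj)) ⟨0, by simp⟩
  have h : ∀ j ∈ range (k + 1),
      (((cgState A b x₀ j).r ⬝ᵥ (cgState A b x₀ j).r)⁻¹ / S) ^ 2 *
          ((cgState A b x₀ j).r ⬝ᵥ (cgState A b x₀ j).r) =
        ((cgState A b x₀ j).r ⬝ᵥ (cgState A b x₀ j).r)⁻¹ / S ^ 2 := by
    intro j hj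
    have hn : (cgState A b x₀ j).r ⬝ᵥ (cgState A b x₀ j).r ≠ 0 := (hpos j hj).ne'
    field_simp
  rw [sum_congr rfl h, ← sum_div, ← hS_def]
  field_simp

/-! ### The `A`-norm of an error is at most the squared residual over `λ_min` -/

/-- For symmetric `A` with all eigenvalues `≥ μ > 0` and `Ax = b`: `(x − y)ᵀA(x − y) ≤ ‖b − Ay‖²/μ`
(`eᵀAe = Σ λ_i e_i² ≤ μ⁻¹ Σ λ_i² e_i² = ‖Ae‖²/μ`). [cite: MeurantTichy2018, §3 (eq:basic) with
`0 < μ ≤ λ_min`] [cite: HornJohnson2013, Thm. 4.2.2 (Rayleigh quotient) via `ResidualErrorBound`] -/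
theorem aNormSq_le_normSq_residual_div [DecidableEq ι] {A : Matrix ι ι ℝ} (hA : A.IsHermitian)
    {μ : ℝ} (hμ : 0 < μ) (hspec : ∀ i, μ ≤ hA.eigenvalues i) {x b : ι → ℝ} (hx : A *ᵥ x = b)
    (y : ι → ℝ) :
    (x - y) ⬝ᵥ A *ᵥ (x - y) ≤ ((b - A *ᵥ y) ⬝ᵥ (b - A *ᵥ y)) / μ := by
  have hres : b - A *ᵥ y = A *ᵥ (x - y) := by rw [mulVec_sub, hx]
  rw [hres, le_div_iff₀ hμ, ResidualBound.mulVec_dotProduct_mulVec_eq_sum hA,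
    KyFan.dotProduct_mulVec_eq_sum_eigen hA, sum_mul]
  refine sum_le_sum fun i _ => ?_
  have hl : 0 ≤ hA.eigenvalues i := hμ.le.trans (hspec i)
  have hsq : 0 ≤ ((hA.eigenvectorBasis i).ofLp ⬝ᵥ (x - y)) ^ 2 := sq_nonneg _
  calc hA.eigenvalues i * ((hA.eigenvectorBasis i).ofLp ⬝ᵥ (x - y)) ^ 2 * μ
      ≤ hA.eigenvalues i * ((hA.eigenvectorBasis i).ofLp ⬝ᵥ (x - y)) ^ 2 * hA.eigenvalues i :=
        mul_le_mul_of_nonneg_left (hspec i) (mul_nonneg hl hsq)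
    _ = hA.eigenvalues i ^ 2 * ((hA.eigenvectorBasis i).ofLp ⬝ᵥ (x - y)) ^ 2 := by ring

/-! ### Theorem 1 -/

/-- **The CG error is at most the minimal residual over `μ`**: for `Ax = b`, `0 < μ ≤ λ(A)` and
`r_k ≠ 0`, `‖x − x_k‖_A² ≤ (Σ_{j≤k} ‖r_j‖⁻²)⁻¹ / μ` — the `A`-norm optimality of `x_k` over
`x₀ + 𝒦_k` against the minimal-residual affine combination of `x_0, …, x_k`.
[cite: MeurantTichy2018, §3 Theorem 1 with eq. (eq:minres)] [cite: Saad2003, §5.1 Prop. 5.2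
(`A`-norm optimality of the Galerkin iterate) via `CGErrorEstimate.aNormSq_error_cgState_le`] -/
theorem aNormSq_error_cgState_le_minRes [DecidableEq ι] {A : Matrix ι ι ℝ} (hA : A.PosDef)
    {μ : ℝ} (hμ : 0 < μ) (hspec : ∀ i, μ ≤ hA.1.eigenvalues i) {b x₀ x : ι → ℝ} (hx : A *ᵥ x = b)
    {k : ℕ} (hr : (cgState A b x₀ k).r ≠ 0) :
    (x - (cgState A b x₀ k).x) ⬝ᵥ A *ᵥ (x - (cgState A b x₀ k).x) ≤
      (∑ j ∈ range (k + 1), ((cgState A b x₀ j).r ⬝ᵥ (cgState A b x₀ j).r)⁻¹)⁻¹ / μ := by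
  set c : ℕ → ℝ := fun j => ((cgState A b x₀ j).r ⬝ᵥ (cgState A b x₀ j).r)⁻¹ /
    ∑ l ∈ range (k + 1), ((cgState A b x₀ l).r ⬝ᵥ (cgState A b x₀ l).r)⁻¹ with hc_def
  have hpos : ∀ j ∈ range (k + 1), 0 < (cgState A b x₀ j).r ⬝ᵥ (cgState A b x₀ j).r := by
    intro j hj
    exact dotProduct_self_pos₄ fun h =>
      hr (cgState_r_eq_zero_of_le A b x₀ (Nat.lt_succ_iff.mp (mem_range.mp hj)) h)
  have hS : 0 < ∑ l ∈ range (k + 1), ((cgState A b x₀ l).r ⬝ᵥ (cgState A b x₀ l).r)⁻¹ :=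
    sum_pos (fun j hj => inv_pos.mpr (hpos j hj)) ⟨0, by simp⟩
  have hc : ∑ j ∈ range (k + 1), c j = 1 := by
    rw [hc_def]
    simp only
    rw [← sum_div, div_self hS.ne']
  set y := ∑ j ∈ range (k + 1), c j • (cgState A b x₀ j).x with hy_def
  calc (x - (cgState A b x₀ k).x) ⬝ᵥ A *ᵥ (x - (cgState A b x₀ k).x)
      ≤ (x - y) ⬝ᵥ A *ᵥ (x - y) :=
        aNormSq_error_cgState_le hA hx k (affineComb_sub_mem_krylov A b x₀ k hc)
    _ ≤ ((b - A *ᵥ y) ⬝ᵥ (b - A *ᵥ y)) / μ := aNormSq_le_normSq_residual_div hA.1 hμ hspec hx y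
    _ = (∑ j ∈ range (k + 1), ((cgState A b x₀ j).r ⬝ᵥ (cgState A b x₀ j).r)⁻¹)⁻¹ / μ := by
        rw [hy_def, residual_affineComb A b x₀ k hc, hc_def, normSq_residual_minRes hA b x₀ hr]

/-- **Meurant–Tichý, Theorem 1.**  For `A` symmetric positive definite with eigenvalues `≥ μ > 0`,
`Ax = b`, and the conjugate-gradient iterates `x_k` with residuals `r_k` and directions `p_k`:
`‖x − x_k‖_A² ≤ (‖r_k‖²/μ)·(‖r_k‖²/‖p_k‖²)`.  (Printed with `<` for `k < n`; when `r_k = 0` both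
sides vanish.) [cite: MeurantTichy2018, §3 Theorem 1 eq. (eq:newbound)] -/
theorem aNormSq_error_cgState_le_meurantTichy [DecidableEq ι] {A : Matrix ι ι ℝ} (hA : A.PosDef)
    {μ : ℝ} (hμ : 0 < μ) (hspec : ∀ i, μ ≤ hA.1.eigenvalues i) {b x₀ x : ι → ℝ} (hx : A *ᵥ x = b)
    (k : ℕ) :
    (x - (cgState A b x₀ k).x) ⬝ᵥ A *ᵥ (x - (cgState A b x₀ k).x) ≤
      ((cgState A b x₀ k).r ⬝ᵥ (cgState A b x₀ k).r) / μ *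
        (((cgState A b x₀ k).r ⬝ᵥ (cgState A b x₀ k).r) /
          ((cgState A b x₀ k).p ⬝ᵥ (cgState A b x₀ k).p)) := by
  by_cases hr : (cgState A b x₀ k).r = 0
  · -- `r_k = 0`: `x_k = x`, both sides are `0`
    have h := cgState_r A b x₀ k
    rw [hr, eq_comm, sub_eq_zero] at h
    have hxk : (cgState A b x₀ k).x = x :=
      (mulVec_injective_iff_isUnit.mpr hA.isUnit (hx.trans h)).symm
    rw [hxk, sub_self, zero_dotProduct, hr, zero_dotProduct, zero_div, zero_mul]
  · have h := aNormSq_error_cgState_le_minRes hA hμ hspec hx hr (x₀ := x₀)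
    have hrr : 0 < (cgState A b x₀ k).r ⬝ᵥ (cgState A b x₀ k).r := dotProduct_self_pos₄ hr
    have hp : (cgState A b x₀ k).p ⬝ᵥ (cgState A b x₀ k).p =
        ((cgState A b x₀ k).r ⬝ᵥ (cgState A b x₀ k).r) ^ 2 *
          ∑ j ∈ range (k + 1), ((cgState A b x₀ j).r ⬝ᵥ (cgState A b x₀ j).r)⁻¹ :=
      cgState_normSq_p_eq hA b x₀ hr
    have hS : 0 < ∑ l ∈ range (k + 1), ((cgState A b x₀ l).r ⬝ᵥ (cgState A b x₀ l).r)⁻¹ := by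
      refine sum_pos (fun j hj => inv_pos.mpr (dotProduct_self_pos₄ fun h0 => hr ?_)) ⟨0, by simp⟩
      exact cgState_r_eq_zero_of_le A b x₀ (Nat.lt_succ_iff.mp (mem_range.mp hj)) h0
    refine h.trans (le_of_eq ?_)
    rw [hp]
    field_simp

/-- **The bound improves the residual bound** `‖x − x_k‖_A² ≤ ‖r_k‖²/μ` by the factor
`φ_k = ‖r_k‖²/‖p_k‖² ≤ 1`. [cite: MeurantTichy2018, §3 (display before (eq:phi): `‖p_k‖² =
‖r_k‖²(1 + δ_k‖p_{k−1}‖²/‖r_{k−1}‖²)`, so `φ_k ≤ 1 = φ_0`)] -/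
theorem meurantTichy_le_residual_bound {A : Matrix ι ι ℝ} (hA : A.PosDef) {μ : ℝ} (hμ : 0 < μ)
    (b x₀ : ι → ℝ) (k : ℕ) :
    ((cgState A b x₀ k).r ⬝ᵥ (cgState A b x₀ k).r) / μ *
        (((cgState A b x₀ k).r ⬝ᵥ (cgState A b x₀ k).r) /
          ((cgState A b x₀ k).p ⬝ᵥ (cgState A b x₀ k).p)) ≤
      ((cgState A b x₀ k).r ⬝ᵥ (cgState A b x₀ k).r) / μ := by
  have hrr := dotProduct_self_nonneg₄ (cgState A b x₀ k).r
  refine mul_le_of_le_one_right (div_nonneg hrr hμ.le) ?_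
  -- `‖r_k‖² ≤ ‖p_k‖²`
  have hle : (cgState A b x₀ k).r ⬝ᵥ (cgState A b x₀ k).r ≤ (cgState A b x₀ k).p ⬝ᵥ (cgState A b x₀ k).p := by
    cases k with
    | zero => simp
    | succ k =>
      rw [cgState_normSq_p_succ hA b x₀ k]
      have := mul_nonneg (sq_nonneg (((cgState A b x₀ (k + 1)).r ⬝ᵥ (cgState A b x₀ (k + 1)).r) /
        ((cgState A b x₀ k).r ⬝ᵥ (cgState A b x₀ k).r))) (dotProduct_self_nonneg₄ (cgState A b x₀ k).p)
      linarith
  by_cases hp : (cgState A b x₀ k).p ⬝ᵥ (cgState A b x₀ k).p = 0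
  · rw [hp, div_zero]; exact zero_le_one
  · exact (div_le_one (lt_of_le_of_ne (dotProduct_self_nonneg₄ _) (Ne.symm hp))).mpr hle

/-- **The delayed bound**: `‖x − x_k‖_A² ≤ Σ_{j=k}^{k+d−1} γ_j‖r_j‖² + ‖r_{k+d}‖⁴/(μ‖p_{k+d}‖²)`
(Hestenes–Stiefel's delay identity of `CGErrorEstimate` with Theorem 1 at step `k + d`).
[cite: MeurantTichy2018, §3 (display after Theorem 1: "combining (eq:delayupper) and
(eq:newbound2) we can get an improved upper bound")] -/
theorem aNormSq_error_cgState_le_meurantTichy_delay [DecidableEq ι] {A : Matrix ι ι ℝ}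
    (hA : A.PosDef) {μ : ℝ} (hμ : 0 < μ) (hspec : ∀ i, μ ≤ hA.1.eigenvalues i) {b x₀ x : ι → ℝ}
    (hx : A *ᵥ x = b) (k d : ℕ) :
    (x - (cgState A b x₀ k).x) ⬝ᵥ A *ᵥ (x - (cgState A b x₀ k).x) ≤
      errEstimate A b x₀ k d +
        ((cgState A b x₀ (k + d)).r ⬝ᵥ (cgState A b x₀ (k + d)).r) / μ *
          (((cgState A b x₀ (k + d)).r ⬝ᵥ (cgState A b x₀ (k + d)).r) /
            ((cgState A b x₀ (k + d)).p ⬝ᵥ (cgState A b x₀ (k + d)).p)) := by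
  rw [aNormSq_error_eq_errEstimate_add hA hx k d]
  have h := aNormSq_error_cgState_le_meurantTichy hA hμ hspec hx (x₀ := x₀) (k + d)
  linarith

/-- **"The bound is decreasing with increasing `k`"**: the minimal-residual value
`(Σ_{j≤k} ‖r_j‖⁻²)⁻¹` is non-increasing in `k`. [cite: MeurantTichy2018, §3 Theorem 1 (last
sentence, "using (eq:minres), the bound (eq:newbound) is monotonically decreasing")] -/
theorem minRes_bound_antitone (A : Matrix ι ι ℝ) (b x₀ : ι → ℝ) {i k : ℕ} (hik : i ≤ k)
    (hpos : 0 < ∑ j ∈ range (i + 1), ((cgState A b x₀ j).r ⬝ᵥ (cgState A b x₀ j).r)⁻¹) :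
    (∑ j ∈ range (k + 1), ((cgState A b x₀ j).r ⬝ᵥ (cgState A b x₀ j).r)⁻¹)⁻¹ ≤
      (∑ j ∈ range (i + 1), ((cgState A b x₀ j).r ⬝ᵥ (cgState A b x₀ j).r)⁻¹)⁻¹ := by
  refine inv_anti₀ hpos ?_
  refine sum_le_sum_of_subset_of_nonneg (range_mono (Nat.succ_le_succ hik)) fun j _ _ => ?_
  exact inv_nonneg.mpr (dotProduct_self_nonneg₄ _)

end ConjugateGradient

end Literature.Analysis.Matrix
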